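import Literature.GroupTheory.Coxeter.CoxeterNumberExceptionalTypes
import Literature.GroupTheory.Coxeter.AffineExceptionalTypes
import Mathlib.Topology.Algebra.Polynomial
import HarnessLib

/-!
# The Coxeter polynomial of the `E_n` series `T_{2,3,n−3}`: `(X − 1)·χ_{E_n} = X^{n−2}(X³ − X − 1) + X³ + X² − 1`; `Ẽ_8 = E_9`: `χ = (X − 1)²(X + 1)(X² + X + 1)(X⁴ + X³ + X² + X + 1)`; `E_10`: `χ` is Lehmer's polynomial `X¹⁰ + X⁹ − X⁷ − X⁶ − X⁵ − X⁴ − X³ + X + 1` and the Coxeter element has infinite order (Stekolshchik 2008 Prop. 13, §25; McMullen 2002)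

Layer `Literature/GroupTheory/Coxeter`, namespace `Literature.GroupTheory.Coxeter`; lane `lit-hodgefound` (Track 2 foundations library; prover seat p18,
generation 54, fifth file — over `CoxeterElementCharpolyExceptionalTypes` (the `E`-pattern Howlett matrix: `howlettU_typeE_of_labels`,
`howlettU_typeE_submatrix_castSucc`, ★ the last-leaf step `det_howlettPencil_typeE_step`, `det_howlettPencil_typeE_three/four`), `CoxeterNumberExceptionalTypes`
(`toMatrix'_geomRep_pow`, the spectrum method), `AffineExceptionalTypes` (the tree's `affineE₈` on `Fin 9` — the `E`-pattern of size `9`) and Mathlib's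
`intermediate_value_Icc`, `Matrix.mem_spectrum_iff_isRoot_charpoly`, `spectrum.subset_polynomial_aeval`).

The `E`-pattern of `CoxeterElementCharpolyExceptionalTypes` (nodes `0, …, n−1`, edges `0–2`, `1–3`, `k–(k+1)` for `2 ≤ k`) makes sense for every `n ≥ 3`: it is
the tree `T_{2,3,n−3}` with arms of `2`, `3`, `n − 3` nodes — `E_3 = A_2A_1`, `E_4 = A_4`, `E_5 = D_5`, `E_6`, `E_7`, `E_8`, `E_9 = Ẽ_8` (affine), `E_10` (hyperbolic), ….
The last-leaf recurrence `D_n = (X + 1)D_{n−1} − X·D_{n−2}` of that file solves in closed form: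

* §1 ★★★ **for every `n ≥ 3` and every Coxeter system whose matrix has the `E`-labels: `(X − 1)·χ(s_0 ⋯ s_{n−1}) = X^{n−2}(X³ − X − 1) + X³ + X² − 1`**
  (`X_sub_one_mul_det_howlettPencil_typeE`, `X_sub_one_mul_charpoly_coxeterElement_typeE`; two-step induction), equivalently for `n ≥ 5` ★★★
  **`χ = X^n + X^{n−1} − Σ_{i=3}^{n−3} X^i + X + 1`** — Stekolshchik's Proposition 13 for `T_{2,3,n−3}` (`det_howlettPencil_typeE`, `charpoly_coxeterElement_typeE`);
* §2 ★★★ **`Ẽ_8 = E_9`** (the tree's `affineE₈`): **`χ = X⁹ + X⁸ − X⁶ − X⁵ − X⁴ − X³ + X + 1 = (X − 1)²(X + 1)(X² + X + 1)(X⁴ + X³ + X² + X + 1)`** — every eigenvalue is a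
  root of unity and `1` is an eigenvalue of multiplicity exactly `2` (the affine Coxeter transformation is not semisimple; compare `isRoot_one_charpoly_coxeterElement_iff`:
  `det A = 0`) (`charpoly_coxeterElement_affineE₈`, `charpoly_coxeterElement_affineE₈_eq_prod`, `rootMultiplicity_one_charpoly_coxeterElement_affineE₈`);
* §3 ★★ `χ_{E_n}(1) = 9 − n`, `χ_{E_n}(2) = 5·2^{n−2} + 11` (`eval_one/two_charpoly_coxeterElement_typeE`), hence ★★★ **for every `n ≥ 10` (indefinite Tits form)
  the Coxeter element of `E_n` has a real eigenvalue `λ ∈ (1, 2)` and INFINITE ORDER, and `W(E_n)` is infinite** (`exists_root_charpoly_coxeterElement_typeE`,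
  `not_isOfFinOrder_coxeterElement_typeE` — if `w^k = 1` then every real eigenvalue `λ` has `λ^k = 1`, `root_pow_eq_one_of_pow_eq_one` —, `infinite_of_labels_typeE`);
  ★★★ **`E_10`** (any Coxeter matrix on `Fin 10` with the `E`-labels — the tree has no named `E_10`): **`χ = X¹⁰ + X⁹ − X⁷ − X⁶ − X⁵ − X⁴ − X³ + X + 1`, Lehmer's
  polynomial** (`charpoly_coxeterElement_typeE₁₀`), with a root `λ ∈ (1, 2)` (Lehmer's number `λ ≈ 1.17628`; here only `1 < λ < 2`), infinite order, `W` infinite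
  (`exists_root_charpoly_coxeterElement_typeE₁₀`, `not_isOfFinOrder_coxeterElement_typeE₁₀`).

PROVED theorems only (no definition, no named fact, no `sorry`: net debt 0); no instance, no notation.  NOT formalised: McMullen's theorem itself (`E_10` minimises the
spectral radius among all Coxeter elements of non-spherical, non-affine Coxeter groups; `λ_{Lehmer}` is the smallest Salem number of this kind), irreducibility of
Lehmer's polynomial, the infinite order of the affine Coxeter element of `Ẽ_8` (needs the Jordan block, not only `χ`).

## Source, verbatim

R. Stekolshchik, *Coxeter Transformations, the McKay correspondence, and the Slodowy correspondence* (BIRS workshop 08w5060, 2008; arXiv:1311.0377)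
[Stekolshchik2013] (held `paper:arxiv-1311.0377`, chunks p0024–p0027).  §24: «`𝒳(A_n) = −(λ + 1)𝒳(A_{n−1}) − λ𝒳(A_{n−2})`, `n > 2`» (Frame).  §25 «The spectral
radius and Lehmer's number (McMullen). **Theorem 12.** Either `ρ(C) = 1`, or `ρ(C) ≥ λ_{Lehmer} ≈ 1.176281...` The spectral radius `ρ(C)` of the Coxeter
transformation for all graphs with indefinite Tits form attains its minimum when the diagram is `E_10`. (McMullen, [McM02]). Lehmer's number is a root [of]
`𝒳(C)` for the diagram `E_10`. `𝒳(C) = x¹⁰ + x⁹ − x⁷ − x⁶ − x⁵ − x⁴ − x³ + x + 1` … In [Leh33], Lehmer established that the polynomial with minimal root `α` … is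
`E10`.»  §26: «The following diagrams belong to the class `T_{2,3,n}`: `D_5` (`n = 2`), `E_6` (`n = 3`), `E_7` (`n = 4`), `E_8` (`n = 5`), `Ẽ_8` (`n = 6`), `E_10`
(`n = 7`). **Proposition 13.** The characteristic polynomials of Coxeter transformations for the diagrams `T_{2,3,n−3}` are as follows:
`𝒳(T_{2,3,n−3}) = λ^n + λ^{n−1} − Σ_{i=3}^{n−3} λ^i + λ + 1`. The spectral radius `ρ(T_{2,3,n−3})` converges to the maximal root `ρ_max` of the equation
`λ³ − λ − 1 = 0` … (Zhang [Zh89])».  C. T. McMullen, *Coxeter groups, Salem numbers and the Hilbert metric*, Publ. Math. IHÉS 95 (2002) 151–183 [Mcmullen2002]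
(the primary source of §25; `lit read doi:10.1007/s102400200001` timed out in this session — cited through Stekolshchik's verbatim report).  J. E. Humphreys,
*Reflection Groups and Coxeter Groups* (1990) [Humphreys1990] §8.4 p. 174 (Howlett's `χ = det(X·U + Uᵗ)`), §2.5 Figure 2 p. 34 (`Ẽ_8`), §6.9 p. 141 (`E_10` among
the hyperbolic Coxeter groups: «`T_{2,3,7}`»).

## Proof notes

`(X − 1)D_n = X^{n−2}(X³ − X − 1) + X³ + X² − 1` holds for `n = 3, 4` (`(X − 1)(X + 1)(X² + X + 1) = X⁴ + X³ − X − 1`, `(X − 1)(1 + X + ⋯ + X⁴) = X⁵ − 1`) and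
propagates along `D_n = (X + 1)D_{n−1} − X D_{n−2}`: `(X + 1)X^{n−3} − X·X^{n−4} = X^{n−2}`, `(X + 1) − X = 1`.  Dividing by `X − 1` (`ℝ[X]` is a domain):
`(X − 1)(X^n + X^{n−1} − Σ_{3 ≤ i ≤ n−3} X^i + X + 1) = X^{n+1} − X^{n−1} − X^{n−2} + X³ + X² − 1` by the geometric sum.  `E_10`: `χ(1) = −1 < 0 < 1291 = χ(2)` and
the intermediate value theorem give a real eigenvalue `λ ∈ (1, 2)`; if `w^k = 1` then `[σ(w)]^k = 1`, `λ` is in the spectrum of `[σ(w)]` (a root of its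
characteristic polynomial), so `λ^k ∈ spec(1) = {1}` — impossible for `λ > 1`, `k ≥ 1`.
-/

namespace Literature.GroupTheory.Coxeter

open CoxeterSystem Matrix Polynomial Real

/-! ### §1 The `E`-series in closed form -/

section Series

/-- The two-step induction behind `X_sub_one_mul_det_howlettPencil_typeE` (private helper). [folklore] -/
private theorem X_sub_one_mul_det_howlettPencil_typeE_aux : ∀ m : ℕ,
    (∀ U : Matrix (Fin (m + 3)) (Fin (m + 3)) ℝ, (∀ i j : Fin (m + 3), U i j = if (i : ℕ) = (j : ℕ) then 1
        else if ((i : ℕ) = 0 ∧ (j : ℕ) = 2) ∨ ((i : ℕ) = 1 ∧ (j : ℕ) = 3) ∨ (2 ≤ (i : ℕ) ∧ (i : ℕ) + 1 = (j : ℕ)) then -1 else 0) →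
      (X - 1) * ((X : ℝ[X]) • U.map C + Uᵀ.map C).det = X ^ (m + 1) * (X ^ 3 - X - 1) + (X ^ 3 + X ^ 2 - 1)) ∧
    (∀ U : Matrix (Fin (m + 4)) (Fin (m + 4)) ℝ, (∀ i j : Fin (m + 4), U i j = if (i : ℕ) = (j : ℕ) then 1
        else if ((i : ℕ) = 0 ∧ (j : ℕ) = 2) ∨ ((i : ℕ) = 1 ∧ (j : ℕ) = 3) ∨ (2 ≤ (i : ℕ) ∧ (i : ℕ) + 1 = (j : ℕ)) then -1 else 0) →
      (X - 1) * ((X : ℝ[X]) • U.map C + Uᵀ.map C).det = X ^ (m + 2) * (X ^ 3 - X - 1) + (X ^ 3 + X ^ 2 - 1))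
  | 0 => ⟨fun U hUE ↦ by rw [det_howlettPencil_typeE_three hUE]; ring, fun U hUE ↦ by rw [det_howlettPencil_typeE_four hUE]; ring⟩
  | m + 1 => by
    refine ⟨(X_sub_one_mul_det_howlettPencil_typeE_aux m).2, fun U hUE ↦ ?_⟩
    have h1 := howlettU_typeE_submatrix_castSucc hUE
    have h2 := howlettU_typeE_submatrix_castSucc h1
    have ih1 := (X_sub_one_mul_det_howlettPencil_typeE_aux m).2 _ h1
    have ih2 := (X_sub_one_mul_det_howlettPencil_typeE_aux m).1 _ h2
    rw [submatrix_submatrix] at ih2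
    rw [det_howlettPencil_typeE_step (k := m + 3) (by omega) hUE]
    linear_combination (X + 1) * ih1 - X * ih2

variable {m : ℕ}

/-- ★★★ **The `E`-series in closed form (McMullen's numerator): for the `E`-pattern Howlett matrix `U` of size `n = m + 3 ≥ 3`,
`(X − 1)·det(X·U + Uᵗ) = X^{n−2}(X³ − X − 1) + X³ + X² − 1`.** [cite: Stekolshchik2013, §26 Proposition 13 («`𝒳(T_{2,3,n−3}) = λ^n + λ^{n−1} − Σ_{i=3}^{n−3} λ^i
+ λ + 1` … converges to the maximal root of `λ³ − λ − 1 = 0`»)] [cite: Mcmullen2002, §5 (Coxeter polynomials of `E_n`)] -/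
theorem X_sub_one_mul_det_howlettPencil_typeE {U : Matrix (Fin (m + 3)) (Fin (m + 3)) ℝ}
    (hUE : ∀ i j : Fin (m + 3), U i j = if (i : ℕ) = (j : ℕ) then 1
      else if ((i : ℕ) = 0 ∧ (j : ℕ) = 2) ∨ ((i : ℕ) = 1 ∧ (j : ℕ) = 3) ∨ (2 ≤ (i : ℕ) ∧ (i : ℕ) + 1 = (j : ℕ)) then -1 else 0) :
    (X - 1) * ((X : ℝ[X]) • U.map C + Uᵀ.map C).det = X ^ (m + 1) * (X ^ 3 - X - 1) + (X ^ 3 + X ^ 2 - 1) :=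
  (X_sub_one_mul_det_howlettPencil_typeE_aux m).1 U hUE

/-- `(X − 1)·Σ_{3 ≤ i < m+3} X^i = X^{m+3} − X³`. [folklore] -/
private theorem X_sub_one_mul_sum_Ico_pow (m : ℕ) : (X - 1) * ∑ i ∈ Finset.Ico 3 (m + 3), (X : ℝ[X]) ^ i = X ^ (m + 3) - X ^ 3 := by
  rw [Finset.sum_Ico_eq_sum_range, show m + 3 - 3 = m by omega]
  simp_rw [pow_add]
  rw [← Finset.mul_sum, mul_comm (X - 1), mul_assoc, geom_sum_mul]
  ring

/-- ★★★ **Stekolshchik's Proposition 13: for the `E`-pattern (`= T_{2,3,n−3}`) of size `n = m + 5 ≥ 5`, `det(X·U + Uᵗ) = X^n + X^{n−1} − Σ_{i=3}^{n−3} X^i + X + 1`**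
(`D_5`, `E_6`, `E_7`, `E_8`, `Ẽ_8`, `E_10`, …). [cite: Stekolshchik2013, §26 Proposition 13] -/
theorem det_howlettPencil_typeE {U : Matrix (Fin (m + 5)) (Fin (m + 5)) ℝ}
    (hUE : ∀ i j : Fin (m + 5), U i j = if (i : ℕ) = (j : ℕ) then 1
      else if ((i : ℕ) = 0 ∧ (j : ℕ) = 2) ∨ ((i : ℕ) = 1 ∧ (j : ℕ) = 3) ∨ (2 ≤ (i : ℕ) ∧ (i : ℕ) + 1 = (j : ℕ)) then -1 else 0) :
    ((X : ℝ[X]) • U.map C + Uᵀ.map C).det = X ^ (m + 5) + X ^ (m + 4) - ∑ i ∈ Finset.Ico 3 (m + 3), (X : ℝ[X]) ^ i + X + 1 := by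
  have hX1 : (X - 1 : ℝ[X]) ≠ 0 := by rw [← C_1]; exact X_sub_C_ne_zero 1
  apply mul_left_cancel₀ hX1
  have hsum := X_sub_one_mul_sum_Ico_pow m
  rw [X_sub_one_mul_det_howlettPencil_typeE (m := m + 2) hUE]
  linear_combination hsum

variable {W : Type*} [Group W]

/-- ★★★ **For EVERY `n = m + 3 ≥ 3` and every Coxeter system whose matrix on `Fin n` has the `E`-labels (edges `0–2`, `1–3`, `k–(k+1)`, `k ≥ 2`; all other
labels `2`): `(X − 1)·χ(s_0 s_1 ⋯ s_{n−1}) = X^{n−2}(X³ − X − 1) + X³ + X² − 1`.** [cite: Stekolshchik2013, §26 Proposition 13] [cite: Mcmullen2002, §5] -/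
theorem X_sub_one_mul_charpoly_coxeterElement_typeE {M : CoxeterMatrix (Fin (m + 3))}
    (hM : ∀ i j : Fin (m + 3), i < j →
      (M i j = 3 ↔ ((i : ℕ) = 0 ∧ (j : ℕ) = 2) ∨ ((i : ℕ) = 1 ∧ (j : ℕ) = 3) ∨ (2 ≤ (i : ℕ) ∧ (i : ℕ) + 1 = (j : ℕ))) ∧ (M i j = 3 ∨ M i j = 2))
    (cs : CoxeterSystem M W) :
    (X - 1) * (LinearMap.toMatrix' (geomRep cs (cs.wordProd (List.finRange (m + 3))))).charpoly = X ^ (m + 1) * (X ^ 3 - X - 1) + (X ^ 3 + X ^ 2 - 1) := by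
  set U : Matrix (Fin (m + 3)) (Fin (m + 3)) ℝ := Matrix.of fun i j ↦ if i = j then 1 else if i < j then 2 * gram M i j else 0 with hUdef
  have hU : ∀ i j, U i j = if i = j then 1 else if i < j then 2 * gram M i j else 0 := fun i j ↦ rfl
  rw [charpoly_coxeterElement_eq_det cs hU, X_sub_one_mul_det_howlettPencil_typeE (howlettU_typeE_of_labels hM hU)]

/-- ★★★ **… and for `n = m + 5 ≥ 5`: `χ(s_0 ⋯ s_{n−1}) = X^n + X^{n−1} − Σ_{i=3}^{n−3} X^i + X + 1`.** [cite: Stekolshchik2013, §26 Proposition 13] -/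
theorem charpoly_coxeterElement_typeE {M : CoxeterMatrix (Fin (m + 5))}
    (hM : ∀ i j : Fin (m + 5), i < j →
      (M i j = 3 ↔ ((i : ℕ) = 0 ∧ (j : ℕ) = 2) ∨ ((i : ℕ) = 1 ∧ (j : ℕ) = 3) ∨ (2 ≤ (i : ℕ) ∧ (i : ℕ) + 1 = (j : ℕ))) ∧ (M i j = 3 ∨ M i j = 2))
    (cs : CoxeterSystem M W) :
    (LinearMap.toMatrix' (geomRep cs (cs.wordProd (List.finRange (m + 5))))).charpoly =
      X ^ (m + 5) + X ^ (m + 4) - ∑ i ∈ Finset.Ico 3 (m + 3), (X : ℝ[X]) ^ i + X + 1 := by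
  set U : Matrix (Fin (m + 5)) (Fin (m + 5)) ℝ := Matrix.of fun i j ↦ if i = j then 1 else if i < j then 2 * gram M i j else 0 with hUdef
  have hU : ∀ i j, U i j = if i = j then 1 else if i < j then 2 * gram M i j else 0 := fun i j ↦ rfl
  rw [charpoly_coxeterElement_eq_det cs hU, det_howlettPencil_typeE (howlettU_typeE_of_labels hM hU)]

end Series

/-! ### §2 `Ẽ_8 = E_9` -/

section AffineE₈

/-- The labels of the tree's `affineE₈` (`Fin 9`): the `E`-pattern of size `9`, edges `0–2`, `1–3`, `2–3`, `3–4`, …, `7–8`. [cite: Humphreys1990, §2.5 Figure 2 p. 34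
(`Ẽ_8`)] -/
theorem labels_affineE₈ : ∀ i j : Fin 9, i < j →
    (affineE₈ i j = 3 ↔ ((i : ℕ) = 0 ∧ (j : ℕ) = 2) ∨ ((i : ℕ) = 1 ∧ (j : ℕ) = 3) ∨ (2 ≤ (i : ℕ) ∧ (i : ℕ) + 1 = (j : ℕ))) ∧
      (affineE₈ i j = 3 ∨ affineE₈ i j = 2) := by
  decide

variable {W : Type*} [Group W] (cs : CoxeterSystem affineE₈ W)

/-- ★★★ **`Ẽ_8`: the characteristic polynomial of the Coxeter element `s_0 ⋯ s_8` is `X⁹ + X⁸ − X⁶ − X⁵ − X⁴ − X³ + X + 1`** (`T_{2,3,6}`, `n = 9` in Proposition 13).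
[cite: Stekolshchik2013, §26 Proposition 13 («`Ẽ_8` (`n = 6`)»)] -/
theorem charpoly_coxeterElement_affineE₈ :
    (LinearMap.toMatrix' (geomRep cs (cs.wordProd (List.finRange 9)))).charpoly = X ^ 9 + X ^ 8 - X ^ 6 - X ^ 5 - X ^ 4 - X ^ 3 + X + 1 := by
  rw [charpoly_coxeterElement_typeE (m := 4) labels_affineE₈ cs, Finset.sum_Ico_succ_top (by norm_num), Finset.sum_Ico_succ_top (by norm_num),
    Finset.sum_Ico_succ_top (by norm_num), Finset.sum_Ico_succ_top (by norm_num), Finset.Ico_self, Finset.sum_empty]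
  ring

/-- ★★★ **`Ẽ_8`: `χ = (X − 1)²·(X + 1)(X² + X + 1)(X⁴ + X³ + X² + X + 1) = Φ₁²Φ₂Φ₃Φ₅`** — every eigenvalue of the affine Coxeter element is a root of unity (of order
`1, 2, 3, 5`: the marks of the arms), and `1` is a double root. [cite: Stekolshchik2013, §26 Proposition 13] -/
theorem charpoly_coxeterElement_affineE₈_eq_prod :
    (LinearMap.toMatrix' (geomRep cs (cs.wordProd (List.finRange 9)))).charpoly = (X - 1) ^ 2 * ((X + 1) * (X ^ 2 + X + 1) * (X ^ 4 + X ^ 3 + X ^ 2 + X + 1)) := by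
  rw [charpoly_coxeterElement_affineE₈]
  ring

/-- ★★ **`1` is an eigenvalue of the affine Coxeter element of `Ẽ_8` of multiplicity exactly `2`** (the Tits form of `Ẽ_8` is degenerate of corank `1`, cf.
`isRoot_one_charpoly_coxeterElement_iff`; the second factor `X − 1` reflects the non-semisimplicity of affine Coxeter transformations). [cite: Stekolshchik2013, §26
Proposition 13] [cite: Humphreys1990, §3.16 Lemma p. 76 (finite case: no eigenvalue `1`), §8.4 p. 174] -/
theorem rootMultiplicity_one_charpoly_coxeterElement_affineE₈ :
    (LinearMap.toMatrix' (geomRep cs (cs.wordProd (List.finRange 9)))).charpoly.rootMultiplicity 1 = 2 := by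
  have hq1 : ¬((X + 1) * (X ^ 2 + X + 1) * (X ^ 4 + X ^ 3 + X ^ 2 + X + 1) : ℝ[X]).IsRoot 1 := by
    rw [IsRoot.def]
    simp only [eval_mul, eval_add, eval_pow, eval_X, eval_one]
    norm_num
  have hq0 : ((X + 1) * (X ^ 2 + X + 1) * (X ^ 4 + X ^ 3 + X ^ 2 + X + 1) : ℝ[X]) ≠ 0 := by
    intro h
    apply hq1
    rw [h, IsRoot.def, eval_zero]
  have hX1 : (X - 1 : ℝ[X]) ≠ 0 := by rw [← C_1]; exact X_sub_C_ne_zero 1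
  rw [charpoly_coxeterElement_affineE₈_eq_prod, rootMultiplicity_mul (mul_ne_zero (pow_ne_zero 2 hX1) hq0), ← C_1, rootMultiplicity_X_sub_C_pow, C_1,
    rootMultiplicity_eq_zero hq1]

end AffineE₈

/-! ### §3 `E_10`: Lehmer's polynomial; the Coxeter element has infinite order -/

section Root

variable {B : Type*} [Fintype B] [DecidableEq B] [Nonempty B] {M : CoxeterMatrix B} {W : Type*} [Group W] (cs : CoxeterSystem M W)

/-- ★★ **If `w^k = 1` then every root `ζ` (in a field `K ⊇ ℝ`) of the characteristic polynomial of `σ(w)` satisfies `ζ^k = 1`** (`ζ` lies in the spectrum of the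
base-changed matrix `A` of `σ(w)`, so `ζ^k ∈ spec(A^k) = spec(1) = {1}`; `S = [σ(w)]` abstracted, `hS` by `rfl`). [cite: Humphreys1990, §3.16 pp. 75–76 («If `ζ` is
a primitive `h`th root of unity in `ℂ`, these eigenvalues are of the form `ζ^m`»)] -/
theorem root_pow_eq_one_of_pow_eq_one {S : Matrix B B ℝ} {K : Type*} [Field K] [Algebra ℝ K] {ζ : K} (hroot : aeval ζ S.charpoly = 0) {w : W}
    (hS : LinearMap.toMatrix' (geomRep cs w) = S) {k : ℕ} (hk : w ^ k = 1) : ζ ^ k = 1 := by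
  have hSk : S ^ k = 1 := by rw [← hS, ← toMatrix'_geomRep_pow, hk, (geomRep cs).map_one, LinearMap.toMatrix'_one]
  set A : Matrix B B K := (algebraMap ℝ K).mapMatrix S with hAdef
  have hAk : A ^ k = 1 := by rw [hAdef, ← map_pow, hSk, map_one]
  have hmem : ζ ∈ spectrum K A := by
    rw [Matrix.mem_spectrum_iff_isRoot_charpoly, hAdef, RingHom.mapMatrix_apply, Matrix.charpoly_map, IsRoot.def, eval_map, ← aeval_def]
    exact hroot
  have h1 : ζ ^ k ∈ spectrum K (aeval A (X ^ k : K[X])) :=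
    spectrum.subset_polynomial_aeval A (X ^ k) ⟨ζ, hmem, by simp only [eval_pow, eval_X]⟩
  rwa [map_pow, aeval_X, hAk, spectrum.one_eq, Set.mem_singleton_iff] at h1

end Root

section Indefinite

variable {W : Type*} [Group W] {m : ℕ} {M : CoxeterMatrix (Fin (m + 5))}

/-- **`χ_{E_n}(1) = 9 − n`** (`n = m + 5 ≥ 5`; from Proposition 13: `1 + 1 − (n − 5) + 1 + 1`): positive for `E_6, E_7, E_8`, zero for `Ẽ_8 = E_9`, negative from `E_10`
on. [cite: Stekolshchik2013, §26 Proposition 13] -/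
theorem eval_one_charpoly_coxeterElement_typeE
    (hM : ∀ i j : Fin (m + 5), i < j →
      (M i j = 3 ↔ ((i : ℕ) = 0 ∧ (j : ℕ) = 2) ∨ ((i : ℕ) = 1 ∧ (j : ℕ) = 3) ∨ (2 ≤ (i : ℕ) ∧ (i : ℕ) + 1 = (j : ℕ))) ∧ (M i j = 3 ∨ M i j = 2))
    (cs : CoxeterSystem M W) : (LinearMap.toMatrix' (geomRep cs (cs.wordProd (List.finRange (m + 5))))).charpoly.eval 1 = 4 - (m : ℝ) := by
  rw [charpoly_coxeterElement_typeE hM cs]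
  simp only [eval_add, eval_sub, eval_pow, eval_X, eval_one, one_pow, eval_finsetSum, Finset.sum_const, Nat.card_Ico, Nat.add_sub_cancel, nsmul_eq_mul,
    mul_one]
  ring

/-- **`χ_{E_n}(2) = 5·2^{n−2} + 11 > 0`** (`n = m + 5`; from `(X − 1)χ = X^{n−2}(X³ − X − 1) + X³ + X² − 1` at `X = 2`). [cite: Stekolshchik2013, §26 Proposition 13] -/
theorem eval_two_charpoly_coxeterElement_typeE
    (hM : ∀ i j : Fin (m + 5), i < j →
      (M i j = 3 ↔ ((i : ℕ) = 0 ∧ (j : ℕ) = 2) ∨ ((i : ℕ) = 1 ∧ (j : ℕ) = 3) ∨ (2 ≤ (i : ℕ) ∧ (i : ℕ) + 1 = (j : ℕ))) ∧ (M i j = 3 ∨ M i j = 2))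
    (cs : CoxeterSystem M W) : (LinearMap.toMatrix' (geomRep cs (cs.wordProd (List.finRange (m + 5))))).charpoly.eval 2 = 5 * 2 ^ (m + 3) + 11 := by
  have h := congrArg (eval 2) (X_sub_one_mul_charpoly_coxeterElement_typeE (m := m + 2) hM cs)
  simp only [eval_mul, eval_add, eval_sub, eval_pow, eval_X, eval_one] at h
  linear_combination h

/-- ★★★ **For `n ≥ 10` (`E_10, E_11, …`: `T_{2,3,n−3}` with an indefinite Tits form) the Coxeter element `s_0 ⋯ s_{n−1}` has a real eigenvalue `λ` with `1 < λ < 2`**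
(`χ(1) = 9 − n < 0 < χ(2)`). [cite: Stekolshchik2013, §26 Proposition 13 («The spectral radius `ρ(T_{2,3,n−3})` converges to the maximal root `ρ_max` of the
equation `λ³ − λ − 1 = 0` … `≈ 1.324717`»), §25 Theorem 12] -/
theorem exists_root_charpoly_coxeterElement_typeE (hm : 5 ≤ m)
    (hM : ∀ i j : Fin (m + 5), i < j →
      (M i j = 3 ↔ ((i : ℕ) = 0 ∧ (j : ℕ) = 2) ∨ ((i : ℕ) = 1 ∧ (j : ℕ) = 3) ∨ (2 ≤ (i : ℕ) ∧ (i : ℕ) + 1 = (j : ℕ))) ∧ (M i j = 3 ∨ M i j = 2))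
    (cs : CoxeterSystem M W) :
    ∃ t : ℝ, 1 < t ∧ t < 2 ∧ (LinearMap.toMatrix' (geomRep cs (cs.wordProd (List.finRange (m + 5))))).charpoly.IsRoot t := by
  have h1 := eval_one_charpoly_coxeterElement_typeE hM cs
  have h2 := eval_two_charpoly_coxeterElement_typeE hM cs
  have hm' : (5 : ℝ) ≤ m := by exact_mod_cast hm
  set L := (LinearMap.toMatrix' (geomRep cs (cs.wordProd (List.finRange (m + 5))))).charpoly with hL
  have hc : ContinuousOn (fun x : ℝ ↦ L.eval x) (Set.Icc 1 2) := L.continuous.continuousOn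
  have h0 : (0 : ℝ) ∈ Set.Icc (L.eval 1) (L.eval 2) := by
    rw [h1, h2]
    constructor
    · linarith
    · positivity
  obtain ⟨t, ⟨ht1, ht2⟩, ht⟩ := intermediate_value_Icc (show (1 : ℝ) ≤ 2 by norm_num) hc h0
  have ht' : L.eval t = 0 := ht
  refine ⟨t, lt_of_le_of_ne ht1 ?_, lt_of_le_of_ne ht2 ?_, ht'⟩
  · rintro rfl
    rw [h1] at ht'
    linarith
  · rintro rfl
    rw [h2] at ht'
    have : (0 : ℝ) < 5 * 2 ^ (m + 3) + 11 := by positivity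
    linarith

/-- ★★★ **For `n ≥ 10` the Coxeter element of `E_n = T_{2,3,n−3}` has infinite order** (a real eigenvalue `λ > 1` is not a root of unity: if `w^k = 1` then `λ^k = 1`).
[cite: Stekolshchik2013, §25 Theorem 12 («Either `ρ(C) = 1`, or `ρ(C) ≥ λ_{Lehmer}`»), §26 Proposition 13] [cite: Mcmullen2002, §1] -/
theorem not_isOfFinOrder_coxeterElement_typeE (hm : 5 ≤ m)
    (hM : ∀ i j : Fin (m + 5), i < j →
      (M i j = 3 ↔ ((i : ℕ) = 0 ∧ (j : ℕ) = 2) ∨ ((i : ℕ) = 1 ∧ (j : ℕ) = 3) ∨ (2 ≤ (i : ℕ) ∧ (i : ℕ) + 1 = (j : ℕ))) ∧ (M i j = 3 ∨ M i j = 2))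
    (cs : CoxeterSystem M W) : ¬IsOfFinOrder (cs.wordProd (List.finRange (m + 5))) := by
  haveI : Nonempty (Fin (m + 5)) := ⟨0⟩
  rw [isOfFinOrder_iff_pow_eq_one]
  rintro ⟨k, hk, hk1⟩
  obtain ⟨t, ht1, -, ht⟩ := exists_root_charpoly_coxeterElement_typeE hm hM cs
  have hroot : aeval t (LinearMap.toMatrix' (geomRep cs (cs.wordProd (List.finRange (m + 5))))).charpoly = 0 := by
    rw [coe_aeval_eq_eval]
    exact ht
  have htk := root_pow_eq_one_of_pow_eq_one cs hroot rfl hk1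
  have hlt : (1 : ℝ) < t ^ k := one_lt_pow₀ ht1 hk.ne'
  rw [htk] at hlt
  exact lt_irrefl _ hlt

/-- ★★ **Coxeter groups of type `E_n = T_{2,3,n−3}`, `n ≥ 10`, are infinite.** [cite: Humphreys1990, §6.9 p. 141 (`T_{2,3,7} = E_10` is hyperbolic), §2.7 p. 38
(the positive definite `T`-shaped graphs are `D_n, E_6, E_7, E_8` only)] [cite: Stekolshchik2013, §26 Proposition 13] -/
theorem infinite_of_labels_typeE (hm : 5 ≤ m)
    (hM : ∀ i j : Fin (m + 5), i < j →
      (M i j = 3 ↔ ((i : ℕ) = 0 ∧ (j : ℕ) = 2) ∨ ((i : ℕ) = 1 ∧ (j : ℕ) = 3) ∨ (2 ≤ (i : ℕ) ∧ (i : ℕ) + 1 = (j : ℕ))) ∧ (M i j = 3 ∨ M i j = 2))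
    (cs : CoxeterSystem M W) : Infinite W := by
  by_contra h
  rw [not_infinite_iff_finite] at h
  exact not_isOfFinOrder_coxeterElement_typeE hm hM cs (isOfFinOrder_of_finite _)

end Indefinite

section TypeE₁₀

variable {W : Type*} [Group W] {M : CoxeterMatrix (Fin 10)}

/-- ★★★ **`E_10`: for every Coxeter system whose matrix on `Fin 10` has the `E`-labels (`T_{2,3,7}`), the characteristic polynomial of the Coxeter element
`s_0 ⋯ s_9` is Lehmer's polynomial `X¹⁰ + X⁹ − X⁷ − X⁶ − X⁵ − X⁴ − X³ + X + 1`.** [cite: Stekolshchik2013, §25 Theorem 12 («(McMullen, [McM02]) … Lehmer's number is a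
root [of] `𝒳(C)` for the diagram `E_10`. `𝒳(C) = x¹⁰ + x⁹ − x⁷ − x⁶ − x⁵ − x⁴ − x³ + x + 1`»), §26 Proposition 13 (`E_10`, `n = 10`)] [cite: Mcmullen2002, §1] -/
theorem charpoly_coxeterElement_typeE₁₀
    (hM : ∀ i j : Fin 10, i < j →
      (M i j = 3 ↔ ((i : ℕ) = 0 ∧ (j : ℕ) = 2) ∨ ((i : ℕ) = 1 ∧ (j : ℕ) = 3) ∨ (2 ≤ (i : ℕ) ∧ (i : ℕ) + 1 = (j : ℕ))) ∧ (M i j = 3 ∨ M i j = 2))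
    (cs : CoxeterSystem M W) :
    (LinearMap.toMatrix' (geomRep cs (cs.wordProd (List.finRange 10)))).charpoly = X ^ 10 + X ^ 9 - X ^ 7 - X ^ 6 - X ^ 5 - X ^ 4 - X ^ 3 + X + 1 := by
  rw [charpoly_coxeterElement_typeE (m := 5) hM cs, Finset.sum_Ico_succ_top (by norm_num), Finset.sum_Ico_succ_top (by norm_num),
    Finset.sum_Ico_succ_top (by norm_num), Finset.sum_Ico_succ_top (by norm_num), Finset.sum_Ico_succ_top (by norm_num), Finset.Ico_self, Finset.sum_empty]
  ring

/-- ★★ **Lehmer's polynomial has a root `λ ∈ (1, 2)` which is an eigenvalue of the Coxeter element of `E_10`** (Lehmer's number `λ ≈ 1.17628`; here only located by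
`χ(1) = −1 < 0 < 1291 = χ(2)`). [cite: Stekolshchik2013, §25 Theorem 12 («`ρ(C) ≥ λ_{Lehmer} ≈ 1.176281`»)] [cite: Mcmullen2002, §1] -/
theorem exists_root_charpoly_coxeterElement_typeE₁₀
    (hM : ∀ i j : Fin 10, i < j →
      (M i j = 3 ↔ ((i : ℕ) = 0 ∧ (j : ℕ) = 2) ∨ ((i : ℕ) = 1 ∧ (j : ℕ) = 3) ∨ (2 ≤ (i : ℕ) ∧ (i : ℕ) + 1 = (j : ℕ))) ∧ (M i j = 3 ∨ M i j = 2))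
    (cs : CoxeterSystem M W) :
    ∃ t : ℝ, 1 < t ∧ t < 2 ∧ (X ^ 10 + X ^ 9 - X ^ 7 - X ^ 6 - X ^ 5 - X ^ 4 - X ^ 3 + X + 1 : ℝ[X]).IsRoot t ∧
      (LinearMap.toMatrix' (geomRep cs (cs.wordProd (List.finRange 10)))).charpoly.IsRoot t := by
  obtain ⟨t, ht1, ht2, ht⟩ := exists_root_charpoly_coxeterElement_typeE (m := 5) le_rfl hM cs
  exact ⟨t, ht1, ht2, by rwa [charpoly_coxeterElement_typeE₁₀ hM cs] at ht, ht⟩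

/-- ★★★ **The Coxeter element of `E_10` has infinite order, and every Coxeter group of type `E_10` is infinite.** [cite: Stekolshchik2013, §25 Theorem 12 («The
spectral radius `ρ(C)` … for all graphs with indefinite Tits form attains its minimum when the diagram is `E_10`»)] [cite: Mcmullen2002, §1] [cite: Humphreys1990,
§6.9 p. 141] -/
theorem not_isOfFinOrder_coxeterElement_typeE₁₀
    (hM : ∀ i j : Fin 10, i < j →
      (M i j = 3 ↔ ((i : ℕ) = 0 ∧ (j : ℕ) = 2) ∨ ((i : ℕ) = 1 ∧ (j : ℕ) = 3) ∨ (2 ≤ (i : ℕ) ∧ (i : ℕ) + 1 = (j : ℕ))) ∧ (M i j = 3 ∨ M i j = 2))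
    (cs : CoxeterSystem M W) : ¬IsOfFinOrder (cs.wordProd (List.finRange 10)) ∧ Infinite W :=
  ⟨not_isOfFinOrder_coxeterElement_typeE (m := 5) le_rfl hM cs, infinite_of_labels_typeE (m := 5) le_rfl hM cs⟩

end TypeE₁₀

end Literature.GroupTheory.Coxeter
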